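import Summits.AtomisticToContinuum.Crystallization.Theorems.FrustratedLawDichotomyCellSymm
import Summits.AtomisticToContinuum.Crystallization.Theorems.FrustratedLawDichotomyCellTriples

/-!
# FrustratedLawDichotomy · crux `AperiodicFrustratedLawGap` (stmt-AtomisticToContinuum-27623) — CELL-SOUND XVI: THE SYMMETRY LEVER ON
INTEGER-TRIPLE LABELS (cell decomp-a2c, lens-5 g113; the one-liners a K-file `Labels` file calls, extracted from TOY ROW 6)

File XV (`CellSymm`) states the label-symmetry lever for an abstract label type.  Every K-file of the atlas labels its sites by integer
triples `ℤ × ℤ × ℤ` (file `CellTriples`: `zT`, `sumT`, parity separation) and its symmetry group by signed permutation matrices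
`spMatZ p s`.  This file packages, once and for all, the plumbing a K-file would otherwise repeat per cell: the label action
`actZ R m = ofVec (R · zT m)` (§1); for a signed permutation — injectivity, invariance of integer distances, of parity, of the cube and
of integer quadratic forms, `M·act = M` from a decided closure, near lists carried along, the strain cell `|FᵀF − 1| ≤ ε` mapped to
itself, and the template scalar of a dyadic template as the INTEGER form `qZ (TZᵀTZ)/D²` (§2); the `ℚ → ℝ` cast bridges — the
commutation `T·R = R·T` decided in `ℚ` gives template equivariance in `ℝ`, and a rational multiplier table decided equivariant in `ℚ`
is equivariant in `ℝ` (§3); and the orbit / class tally `Σ_{m ∈ MN} f (rep m) =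
Σ_{r ∈ Reps} |fibre r|·f r` for any key `rep : ι → κ` (§4).  With these, the hypotheses `hP hM hMI hnb ha hω hB` of (XV) `nn_of_reps` /
`hf_of_reps` / `fc_of_reps` are each one line from DECIDED integer/rational facts (`decide` / `decide +kernel` once per group element),
never a list comparison.

House conventions: SI units · italic scalars, bold vectors, sans-serif tensors · numbered formulae only when referenced · en-dash for
ranges · References = cited works, numbered, alphabetical · no footnotes; Remarks at section ends · British spelling, -ise · Lennard-Jones
hyphenated; NASH capitalised as the Statement's notion · "folklore" tags standard bookkeeping; no new references are cited in this file.
-/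

noncomputable section

namespace Summit.AtomisticToContinuum.Crystallization.Theorems.FrustratedLawDichotomyCellSymmZ3

open scoped BigOperators
open Summit.AtomisticToContinuum.Crystallization.Theorems.FrustratedLawDichotomyCellClasses (ballL)
open Summit.AtomisticToContinuum.Crystallization.Theorems.FrustratedLawDichotomyCellTriples (zT sumT zT_injective)
open Summit.AtomisticToContinuum.Crystallization.Theorems.FrustratedLawDichotomyCellSymm

/-! ### §1 The label action of an integer matrix -/

/-- vector → triple. [folklore] -/
def ofVec (v : Fin 3 → ℤ) : ℤ × ℤ × ℤ := (v 0, v 1, v 2)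

/-- [folklore] -/
@[simp] theorem zT_ofVec (v : Fin 3 → ℤ) : zT (ofVec v) = v := by
  funext i; fin_cases i <;> rfl

/-- [folklore] -/
@[simp] theorem ofVec_zT (m : ℤ × ℤ × ℤ) : ofVec (zT m) = m := rfl

/-- the label action `m ↦ R·m` of an integer matrix on integer triples. [folklore] -/
def actZ (R : Matrix (Fin 3) (Fin 3) ℤ) (m : ℤ × ℤ × ℤ) : ℤ × ℤ × ℤ := ofVec (R.mulVec (zT m))

/-- [folklore] -/
theorem zT_actZ (R : Matrix (Fin 3) (Fin 3) ℤ) (m : ℤ × ℤ × ℤ) : zT (actZ R m) = R.mulVec (zT m) := zT_ofVec _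

/-- [folklore] -/
theorem sumT_eq_sum (t : ℤ × ℤ × ℤ) : sumT t = ∑ i, zT t i := by
  simp [sumT, Fin.sum_univ_three]

/-! ### §2 Signed permutations: the structural invariances -/

section SignedPerm

variable {p : Fin 3 → Fin 3} (hp : Function.Injective p) {s : Fin 3 → ℤ} (hs : ∀ j, s j = 1 ∨ s j = -1)
include hp hs

/-- the action of a signed permutation is injective on labels. [folklore] -/
theorem actZ_injective : Function.Injective (actZ (spMatZ p s)) := fun m m' h => by
  have h1 := congrArg zT h
  rw [zT_actZ, zT_actZ] at h1
  exact zT_injective (spMatZ_mulVec_injective hp hs h1)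

/-- integer distances are invariant. [folklore] -/
theorem sumSq_zT_actZ (x y : ℤ × ℤ × ℤ) :
    ∑ i, (zT (actZ (spMatZ p s) x) i - zT (actZ (spMatZ p s) y) i) ^ 2 = ∑ i, (zT x i - zT y i) ^ 2 := by
  rw [zT_actZ, zT_actZ]; exact sumSq_sub_spMatZ_mulVec hp hs _ _

/-- integer lengths are invariant. [folklore] -/
theorem sumSq_zT_actZ' (x : ℤ × ℤ × ℤ) : ∑ i, zT (actZ (spMatZ p s) x) i ^ 2 = ∑ i, zT x i ^ 2 := by
  rw [zT_actZ]; exact sumSq_spMatZ_mulVec hp hs _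

/-- parity is invariant. [folklore] -/
theorem even_sumT_actZ_iff (m : ℤ × ℤ × ℤ) : Even (sumT (actZ (spMatZ p s) m)) ↔ Even (sumT m) := by
  rw [sumT_eq_sum, sumT_eq_sum, zT_actZ]; exact even_sum_spMatZ_mulVec_iff hp hs _

/-- the cube `|zᵢ| ≤ N` is invariant. [folklore] -/
theorem abs_zT_actZ_le {m : ℤ × ℤ × ℤ} {N : ℤ} (h : ∀ i, |zT m i| ≤ N) : ∀ i, |zT (actZ (spMatZ p s) m) i| ≤ N := by
  rw [zT_actZ]; exact abs_spMatZ_mulVec_le hp hs h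

/-- `M·act = M` from a decided closure, WITHOUT list comparison. [folklore] -/
theorem image_actZ_eq {M : Finset (ℤ × ℤ × ℤ)} (hclos : ∀ x ∈ M, actZ (spMatZ p s) x ∈ M) :
    M.image (actZ (spMatZ p s)) = M :=
  image_eq_of_mapsTo (actZ_injective hp hs) hclos

/-- near lists (integer balls) are carried along — the `hnb`/`hnbh` hypotheses of (XV) `nn_of_reps`/`hf_of_reps`. [folklore] -/
theorem ballL_actZ {M : Finset (ℤ × ℤ × ℤ)} (hM : M.image (actZ (spMatZ p s)) = M) (ℓ : ℤ) :
    ∀ m ∈ M, ballL M zT ℓ (actZ (spMatZ p s) m) = (ballL M zT ℓ m).image (actZ (spMatZ p s)) :=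
  fun m _ => ballL_symm (actZ_injective hp hs) hM (sumSq_zT_actZ hp hs) ℓ m

/-- the strain cell `|FᵀF − 1| ≤ ε` is mapped to itself by `F ↦ F·R` — the `hB` hypothesis. [folklore] -/
theorem nearId_mul_spMatZ {F : Matrix (Fin 3) (Fin 3) ℝ} {ε : ℝ}
    (hG : ∀ i j, |(F.transpose * F) i j - (if i = j then 1 else 0)| ≤ ε) :
    ∀ i j, |((F * (spMatZ p s).map fun t : ℤ => (t : ℝ)).transpose * (F * (spMatZ p s).map fun t : ℤ => (t : ℝ))) i j
      - (if i = j then 1 else 0)| ≤ ε := by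
  rw [spMatZ_map]
  exact nearId_mul_spMat hG hp fun j => by rcases hs j with h | h <;> simp [h]

end SignedPerm

/-- an integer quadratic form on labels (e.g. `D²·TᵀT` for a dyadic template `T`). [folklore] -/
def qZ (A : Matrix (Fin 3) (Fin 3) ℤ) (m : ℤ × ℤ × ℤ) : ℤ := dotProduct (zT m) (A.mulVec (zT m))

/-- it is invariant when `RᵀAR = A` (decided once per group element) — so template-scalar windows are invariant label sets.
[folklore] -/
theorem qZ_actZ (A R : Matrix (Fin 3) (Fin 3) ℤ) (hA : R.transpose * A * R = A) (m : ℤ × ℤ × ℤ) :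
    qZ A (actZ R m) = qZ A m := by
  unfold qZ; rw [zT_actZ]; exact quadForm_invariant A R hA _

/-- the integer Gram identity `Σᵢ (T z)ᵢ² = z·(TᵀT) z`. [folklore] -/
theorem sumSq_mulVec_eq_dot (TZ : Matrix (Fin 3) (Fin 3) ℤ) (z : Fin 3 → ℤ) :
    ∑ i, (TZ.mulVec z i) ^ 2 = dotProduct z ((TZ.transpose * TZ).mulVec z) := by
  rw [← Matrix.mulVec_mulVec, Matrix.dotProduct_mulVec, Matrix.vecMul_transpose]
  simp [dotProduct, sq]

/-- ★ the template scalar of a DYADIC linear template is an integer quadratic form: if `TZ = D·TQ` entrywise then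
`D²·Σᵢ (TQ z)ᵢ² = z·(TZᵀTZ) z` — so the shell windows `(1 ∓ 3ε)·Σᵢ(TQ z)ᵢ²` of (261) are read off the INTEGER
`qZ (TZᵀTZ)`, the class key of a label is that integer, and class tables are tallied by `sum_over_reps` with
`rep := qZ (TZᵀTZ)`. [folklore] -/
theorem sumSq_linTemplate_eq_dotZ (TQ : Matrix (Fin 3) (Fin 3) ℚ) (TZ : Matrix (Fin 3) (Fin 3) ℤ) (D : ℚ)
    (hT : ∀ i j, (TZ i j : ℚ) = D * TQ i j) (z : Fin 3 → ℤ) :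
    (D : ℝ) ^ 2 * ∑ i, ((TQ.map fun q : ℚ => (q : ℝ)).mulVec (fun j => (z j : ℝ)) i) ^ 2
      = ((dotProduct z ((TZ.transpose * TZ).mulVec z) : ℤ) : ℝ) := by
  have hrow : ∀ i, (TZ.map fun t : ℤ => (t : ℝ)).mulVec (fun j => (z j : ℝ)) i
      = (D : ℝ) * (TQ.map fun q : ℚ => (q : ℝ)).mulVec (fun j => (z j : ℝ)) i := by
    intro i
    simp only [Matrix.mulVec, dotProduct, Matrix.map_apply, Finset.mul_sum]
    refine Finset.sum_congr rfl fun j _ => ?_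
    have h' : ((TZ i j : ℤ) : ℝ) = ((D : ℚ) : ℝ) * ((TQ i j : ℚ) : ℝ) := by exact_mod_cast hT i j
    rw [h']; ring
  rw [← sumSq_mulVec_eq_dot]
  push_cast
  rw [Finset.mul_sum]
  refine Finset.sum_congr rfl fun i _ => ?_
  have hc : ((TZ.mulVec z i : ℤ) : ℝ) = (TZ.map fun t : ℤ => (t : ℝ)).mulVec (fun j => (z j : ℝ)) i :=
    congrFun (cast_mulVec TZ z) i
  rw [hc, hrow i]; ring

/-- label form: `Σᵢ (TQ·zT m)ᵢ² = qZ (TZᵀTZ) m / D²`. [folklore] -/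
theorem sumSq_linTemplate_eq_qZ_div (TQ : Matrix (Fin 3) (Fin 3) ℚ) (TZ : Matrix (Fin 3) (Fin 3) ℤ) {D : ℚ} (hD : D ≠ 0)
    (hT : ∀ i j, (TZ i j : ℚ) = D * TQ i j) (m : ℤ × ℤ × ℤ) :
    ∑ i, ((TQ.map fun q : ℚ => (q : ℝ)).mulVec (fun j => (zT m j : ℝ)) i) ^ 2 = (qZ (TZ.transpose * TZ) m : ℝ) / (D : ℝ) ^ 2 := by
  have hD' : ((D : ℚ) : ℝ) ^ 2 ≠ 0 := pow_ne_zero 2 (by exact_mod_cast hD)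
  rw [eq_div_iff hD', mul_comm]
  exact sumSq_linTemplate_eq_dotZ TQ TZ D hT (zT m)

/-! ### §3 The `ℚ → ℝ` cast bridges -/

/-- the commutation `T·R = R·T`, decided in `ℚ`, holds for the real casts. [folklore] -/
theorem map_comm_of_commQ (TQ : Matrix (Fin 3) (Fin 3) ℚ) (RZ : Matrix (Fin 3) (Fin 3) ℤ)
    (h : TQ * RZ.map (fun t : ℤ => (t : ℚ)) = RZ.map (fun t : ℤ => (t : ℚ)) * TQ) :
    TQ.map (fun q : ℚ => (q : ℝ)) * RZ.map (fun t : ℤ => (t : ℝ))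
      = RZ.map (fun t : ℤ => (t : ℝ)) * TQ.map (fun q : ℚ => (q : ℝ)) := by
  have h' := congrArg (fun A : Matrix (Fin 3) (Fin 3) ℚ => A.map (Rat.castHom ℝ)) h
  simp only [Matrix.map_mul, Matrix.map_map] at h'
  have e2 : RZ.map (⇑(Rat.castHom ℝ) ∘ fun t : ℤ => (t : ℚ)) = RZ.map fun t : ℤ => (t : ℝ) := by
    ext i j; simp
  rw [e2] at h'
  exact h'

/-- ★ template equivariance for a rational linear template — the `ha` hypothesis of (XV) `nn_of_reps`, from the `ℚ` decision
`T·R = R·T`. [folklore] -/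
theorem linTemplate_actZ (TQ : Matrix (Fin 3) (Fin 3) ℚ) (RZ : Matrix (Fin 3) (Fin 3) ℤ)
    (h : TQ * RZ.map (fun t : ℤ => (t : ℚ)) = RZ.map (fun t : ℤ => (t : ℚ)) * TQ) (x : ℤ × ℤ × ℤ) :
    (TQ.map fun q : ℚ => (q : ℝ)).mulVec (fun j => (zT (actZ RZ x) j : ℝ))
      = (RZ.map fun t : ℤ => (t : ℝ)).mulVec ((TQ.map fun q : ℚ => (q : ℝ)).mulVec fun j => (zT x j : ℝ)) := by
  rw [zT_actZ]; exact template_equivar _ RZ (map_comm_of_commQ TQ RZ h) (zT x)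

/-- ★ a rational vector table (the multipliers `ω = Y_of_record`) decided equivariant in `ℚ` is equivariant in `ℝ` — the `hω`
hypothesis. [folklore] -/
theorem castVec_equivar (RZ : Matrix (Fin 3) (Fin 3) ℤ) {u v : Fin 3 → ℚ} (h : v = (RZ.map fun t : ℤ => (t : ℚ)).mulVec u) :
    (fun i => (v i : ℝ)) = (RZ.map fun t : ℤ => (t : ℝ)).mulVec fun i => (u i : ℝ) := by
  funext i
  rw [h]
  simp only [Matrix.mulVec, dotProduct, Matrix.map_apply]
  push_cast
  rfl

/-! ### §4 The orbit tally -/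

/-- `Σ_{m ∈ MN} f (rep m) = Σ_{r ∈ Reps} |{m ∈ MN : rep m = r}|·f r` — per-representative (or per-CLASS: `rep` may be any key, e.g. the
integer template scalar `qZ A`) numbers enter the K tally with decided fibre cards. [folklore] -/
theorem sum_over_reps {ι κ : Type*} [DecidableEq κ] {MN : Finset ι} {Reps : Finset κ} {rep : ι → κ} (h : ∀ m ∈ MN, rep m ∈ Reps)
    (f : κ → ℝ) : ∑ m ∈ MN, f (rep m) = ∑ r ∈ Reps, ((MN.filter fun m => rep m = r).card : ℝ) * f r := by
  rw [← Finset.sum_fiberwise_of_maps_to h]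
  refine Finset.sum_congr rfl fun r _ => ?_
  rw [Finset.sum_congr rfl fun m hm => by rw [(Finset.mem_filter.mp hm).2], Finset.sum_const, nsmul_eq_mul]

end Summit.AtomisticToContinuum.Crystallization.Theorems.FrustratedLawDichotomyCellSymmZ3

end
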